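import Literature.Geometry.Lorentzian.CoordRicciWaveGauge
import Mathlib.Analysis.Calculus.BumpFunction.FiniteDimension
import HarnessLib

/-!
# Cutting off a coordinate metric near a point, and slice-hyperbolic forms

Coordinate-components support file (everything proved). Two tools of the localisation of
hyperbolic existence theorems to a neighbourhood of a point (Hawking–Ellis 1973, §7.4–7.5: "we may
modify the metric outside a small neighbourhood so that …"; Friedrichs 1954, §1, coefficients
constant outside a compact set):

* `IsMetricOn.exists_cutoff` — for a smooth nondegenerate `G` on an open `T ∋ p₀` and any OPEN
  set `𝒰` of admissible bilinear forms containing `G(p₀)` (all of them invertible), the convex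
  cut-off `Ĝ = G(p₀) + χ·(G − G(p₀))` (`χ` a smooth bump at `p₀` supported where `G` is close to
  `G(p₀)`) is a smooth nondegenerate field on the WHOLE space, equal to `G` near `p₀`, equal to
  the constant `G(p₀)` outside a ball, with all its values in `𝒰`;
* `IsSliceHyperbolic b M` — the open (`isOpen_setOf_isSliceHyperbolic`) condition on a form `M`
  in a basis `b` indexed by `Option ι` (`none` = time): `M` invertible, `g⁰⁰ < 0`, and the
  spatial symbol `Q^{jk} = g^{jk} − g^{0j}g^{0k}/g⁰⁰` positive definite; and the resulting
  `IsMetricOn.exists_sliceHyperbolic_cutoff`.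

## References

* S. W. Hawking, G. F. R. Ellis, *The large scale structure of space-time*, CUP 1973, §7.4–7.5.
  [HawkingEllis1973CUP]
* K. O. Friedrichs, *Symmetric hyperbolic linear differential equations*, CPAM 7 (1954), §1.
  [Friedrichs1954]
-/

noncomputable section

-- instance search through nested operator types `E →L E →L ℝ`
set_option maxSynthPendingDepth 3

open Set Filter Metric Function
open scoped Topology ContDiff

namespace Literature.Geometry.Lorentzian

namespace MetricCoord

variable {E : Type*} [NormedAddCommGroup E] [NormedSpace ℝ E] [FiniteDimensional ℝ E]

/-! ### The convex cut-off of a metric near a point -/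

section Cutoff

variable {G : E → E →L[ℝ] E →L[ℝ] ℝ} {T : Set E} {p₀ : E}

/-- **Cutting off a coordinate metric near a point.** Let `G` be smooth, symmetric and
nondegenerate on the open set `T ∋ p₀`, and let `𝒰` be an open set of invertible forms with
`G(p₀) ∈ 𝒰`. Then there is a smooth symmetric nondegenerate field `Ĝ` on the whole space with
values in `𝒰`, equal to `G` on a ball around `p₀` inside `T` and equal to the constant `G(p₀)`
outside a larger ball. [cite: HawkingEllis1973CUP, §7.5] -/
theorem IsMetricOn.exists_cutoff (hG : IsMetricOn G T) (hp₀ : p₀ ∈ T)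
    {𝒰 : Set (E →L[ℝ] E →L[ℝ] ℝ)} (h𝒰 : IsOpen 𝒰) (h0 : G p₀ ∈ 𝒰)
    (hinv : ∀ M ∈ 𝒰, M.IsInvertible) :
    ∃ Ĝ : E → E →L[ℝ] E →L[ℝ] ℝ, IsMetricOn Ĝ univ ∧
      (∃ r, 0 < r ∧ ball p₀ r ⊆ T ∧ ∀ p ∈ ball p₀ r, Ĝ p = G p) ∧
      (∃ R, ∀ p, R ≤ dist p p₀ → Ĝ p = G p₀) ∧ ∀ p, Ĝ p ∈ 𝒰 := by
  -- `ε`: the ball of forms around `G p₀` inside `𝒰`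
  obtain ⟨ε, hε, hεU⟩ := Metric.isOpen_iff.1 h𝒰 (G p₀) h0
  -- `δ`: the ball around `p₀` inside `T` on which `G` is `ε`-close to `G p₀`
  have hcont : ContinuousAt G p₀ :=
    (hG.contDiffOn.continuousOn.continuousWithinAt hp₀).continuousAt (hG.isOpen.mem_nhds hp₀)
  obtain ⟨δ, hδ, hδT, hδε⟩ : ∃ δ, 0 < δ ∧ ball p₀ δ ⊆ T ∧ ∀ p ∈ ball p₀ δ, dist (G p) (G p₀) < ε := by
    obtain ⟨δ₁, hδ₁, h₁⟩ := Metric.isOpen_iff.1 hG.isOpen p₀ hp₀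
    obtain ⟨δ₂, hδ₂, h₂⟩ := Metric.continuousAt_iff.1 hcont ε hε
    refine ⟨min δ₁ δ₂, lt_min hδ₁ hδ₂, fun p hp ↦ h₁ (ball_subset_ball (min_le_left _ _) hp),
      fun p hp ↦ h₂ (ball_subset_ball (min_le_right _ _) hp)⟩
  -- the bump
  let χ : ContDiffBump p₀ := ⟨δ / 4, δ / 2, by linarith, by linarith⟩
  set Ĝ : E → E →L[ℝ] E →L[ℝ] ℝ := fun p ↦ G p₀ + (χ : E → ℝ) p • (G p - G p₀) with hĜ
  have hχ0 : ∀ p, δ / 2 ≤ dist p p₀ → (χ : E → ℝ) p = 0 := fun p hp ↦ χ.zero_of_le_dist hp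
  have hχ1 : ∀ p, dist p p₀ ≤ δ / 4 → (χ : E → ℝ) p = 1 := fun p hp ↦
    χ.one_of_mem_closedBall (mem_closedBall.2 hp)
  -- all values lie in the `ε`-ball around `G p₀`
  have hball : ∀ p, Ĝ p ∈ ball (G p₀) ε := by
    intro p
    rw [mem_ball, dist_eq_norm]
    have : Ĝ p - G p₀ = (χ : E → ℝ) p • (G p - G p₀) := by simp [hĜ]
    rw [this, norm_smul, Real.norm_of_nonneg (χ.nonneg' p)]
    by_cases hp : p ∈ ball p₀ δ
    · have hd : ‖G p - G p₀‖ < ε := by rw [← dist_eq_norm]; exact hδε p hp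
      calc (χ : E → ℝ) p * ‖G p - G p₀‖ ≤ 1 * ‖G p - G p₀‖ :=
            mul_le_mul_of_nonneg_right (χ.le_one (c := p₀)) (norm_nonneg _)
        _ < ε := by rw [one_mul]; exact hd
    · rw [hχ0 p (by rw [mem_ball, not_lt] at hp; linarith), zero_mul]
      exact hε
  have hU : ∀ p, Ĝ p ∈ 𝒰 := fun p ↦ hεU (hball p)
  -- agreement near `p₀` and far from `p₀`
  have hnear : ∀ p ∈ ball p₀ (δ / 4), Ĝ p = G p := fun p hp ↦ by
    simp only [hĜ, hχ1 p (mem_ball.1 hp).le, one_smul]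
    abel
  have hfar : ∀ p, δ / 2 ≤ dist p p₀ → Ĝ p = G p₀ := fun p hp ↦ by
    simp only [hĜ, hχ0 p hp, zero_smul, add_zero]
  -- smoothness
  have hsmooth : ContDiff ℝ ∞ Ĝ := by
    rw [contDiff_iff_contDiffAt]
    intro p
    by_cases hp : p ∈ T
    · have hGp : ContDiffAt ℝ ∞ G p := (hG.contDiffOn p hp).contDiffAt (hG.isOpen.mem_nhds hp)
      exact contDiffAt_const.add ((χ.contDiff.contDiffAt).smul (hGp.sub contDiffAt_const))
    · -- outside `T` the field is locally the constant `G p₀`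
      have hdist : δ ≤ dist p p₀ := by
        by_contra h
        exact hp (hδT (mem_ball.2 (not_le.1 h)))
      have hO : ∀ᶠ q in 𝓝 p, Ĝ q = G p₀ := by
        have hopen : IsOpen {q : E | δ / 2 < dist q p₀} :=
          isOpen_lt continuous_const (continuous_id.dist continuous_const)
        filter_upwards [hopen.mem_nhds (show δ / 2 < dist p p₀ by linarith)] with q hq
        exact hfar q (le_of_lt hq)
      exact (contDiffAt_const (c := G p₀)).congr_of_eventuallyEq hO
  -- symmetry
  have hsymm : ∀ p (v w : E), Ĝ p v w = Ĝ p w v := by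
    intro p v w
    by_cases hp : p ∈ T
    · simp [hĜ, hG.symm p hp v w, hG.symm p₀ hp₀ v w]
    · have hdist : δ ≤ dist p p₀ := by
        by_contra h
        exact hp (hδT (mem_ball.2 (not_le.1 h)))
      rw [hfar p (by linarith)]
      exact hG.symm p₀ hp₀ v w
  refine ⟨Ĝ, ⟨isOpen_univ, hsmooth.contDiffOn, fun p _ v w ↦ hsymm p v w,
    fun p _ ↦ hinv _ (hU p)⟩, ⟨δ / 4, by linarith, ?_, hnear⟩, ⟨δ / 2, hfar⟩, hU⟩
  exact (ball_subset_ball (by linarith)).trans hδT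

end Cutoff

/-! ### Positive-definite matrices form an open set -/

section PosDefMatrix

variable {ι : Type*} [Fintype ι]

/-- The quadratic form `ξ ↦ Σ_{jk} N_{jk} ξ_j ξ_k` of a square matrix. [folklore] -/
def mqf (N : ι → ι → ℝ) (ξ : ι → ℝ) : ℝ := ∑ j, ∑ k, N j k * ξ j * ξ k

/-- **Positive definiteness** of a square matrix (as a quadratic form). [folklore] -/
def MIsPosDef (N : ι → ι → ℝ) : Prop := ∀ ξ : ι → ℝ, ξ ≠ 0 → 0 < mqf N ξ

/-- Homogeneity of the quadratic form. [folklore] -/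
theorem mqf_smul (N : ι → ι → ℝ) (c : ℝ) (ξ : ι → ℝ) : mqf N (c • ξ) = c ^ 2 * mqf N ξ := by
  simp only [mqf, Pi.smul_apply, smul_eq_mul, Finset.mul_sum]
  exact Finset.sum_congr rfl fun j _ ↦ Finset.sum_congr rfl fun k _ ↦ by ring

/-- The quadratic form is Lipschitz in the matrix: `|q_N(ξ) − q_{N'}(ξ)| ≤ (#ι)² ‖N − N'‖ ‖ξ‖²`.
[folklore] -/
theorem abs_mqf_sub_le (N N' : ι → ι → ℝ) (ξ : ι → ℝ) :
    |mqf N ξ - mqf N' ξ| ≤ (Fintype.card ι : ℝ) ^ 2 * ‖N - N'‖ * ‖ξ‖ ^ 2 := by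
  have hsub : mqf N ξ - mqf N' ξ = ∑ j, ∑ k, (N - N') j k * ξ j * ξ k := by
    simp only [mqf, ← Finset.sum_sub_distrib, Pi.sub_apply]
    exact Finset.sum_congr rfl fun j _ ↦ Finset.sum_congr rfl fun k _ ↦ by ring
  rw [hsub]
  have hentry : ∀ j k, |(N - N') j k| ≤ ‖N - N'‖ := fun j k ↦ by
    rw [← Real.norm_eq_abs]
    exact (norm_le_pi_norm ((N - N') j) k).trans (norm_le_pi_norm (N - N') j)
  have hξ : ∀ j, |ξ j| ≤ ‖ξ‖ := fun j ↦ by rw [← Real.norm_eq_abs]; exact norm_le_pi_norm ξ j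
  calc |∑ j, ∑ k, (N - N') j k * ξ j * ξ k|
      ≤ ∑ j, |∑ k, (N - N') j k * ξ j * ξ k| := Finset.abs_sum_le_sum_abs _ _
    _ ≤ ∑ j, ∑ k, |(N - N') j k * ξ j * ξ k| :=
        Finset.sum_le_sum fun j _ ↦ Finset.abs_sum_le_sum_abs _ _
    _ ≤ ∑ _j : ι, ∑ _k : ι, ‖N - N'‖ * ‖ξ‖ * ‖ξ‖ := by
        refine Finset.sum_le_sum fun j _ ↦ Finset.sum_le_sum fun k _ ↦ ?_
        rw [abs_mul, abs_mul]
        exact mul_le_mul (mul_le_mul (hentry j k) (hξ j) (abs_nonneg _) (norm_nonneg _)) (hξ k)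
          (abs_nonneg _) (mul_nonneg (norm_nonneg _) (norm_nonneg _))
    _ = (Fintype.card ι : ℝ) ^ 2 * ‖N - N'‖ * ‖ξ‖ ^ 2 := by
        simp only [Finset.sum_const, Finset.card_univ, nsmul_eq_mul]
        ring

/-- The quadratic form is continuous in `ξ`. [folklore] -/
theorem continuous_mqf (N : ι → ι → ℝ) : Continuous (mqf N) := by
  unfold mqf
  exact continuous_finsetSum _ fun j _ ↦ continuous_finsetSum _ fun k _ ↦
    ((continuous_const.mul (continuous_apply j)).mul (continuous_apply k))

/-- **Positive-definite matrices form an open set.** [folklore] -/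
theorem isOpen_setOf_mIsPosDef : IsOpen {N : ι → ι → ℝ | MIsPosDef N} := by
  rcases isEmpty_or_nonempty ι with hι | hι
  · have : {N : ι → ι → ℝ | MIsPosDef N} = univ := by
      refine eq_univ_of_forall fun N ξ hξ ↦ ?_
      exact absurd (Subsingleton.elim ξ 0) hξ
    rw [this]
    exact isOpen_univ
  refine Metric.isOpen_iff.2 fun N₀ hN₀ ↦ ?_
  -- the minimum of the quadratic form on the unit sphere
  have hS : IsCompact (sphere (0 : ι → ℝ) 1) := isCompact_sphere 0 1
  obtain ⟨i⟩ := hι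
  have hne : (sphere (0 : ι → ℝ) 1).Nonempty := by
    classical
    refine ⟨Pi.single i 1, ?_⟩
    rw [mem_sphere_zero_iff_norm, Pi.norm_single, norm_one]
  obtain ⟨ξ₀, hξ₀S, hmin⟩ := hS.exists_isMinOn hne (continuous_mqf N₀).continuousOn
  have hξ₀ : ξ₀ ≠ 0 := by
    intro h
    rw [h, mem_sphere_zero_iff_norm, norm_zero] at hξ₀S
    exact zero_ne_one hξ₀S
  set lam := mqf N₀ ξ₀ with hlam
  have hlam0 : 0 < lam := hN₀ ξ₀ hξ₀
  set c : ℝ := (Fintype.card ι : ℝ) ^ 2 with hc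
  have hc0 : 0 ≤ c := by positivity
  refine ⟨lam / (c + 1), div_pos hlam0 (by linarith), fun N hN ξ hξ ↦ ?_⟩
  rw [mem_ball, dist_eq_norm] at hN
  -- normalise `ξ`
  have hnξ : 0 < ‖ξ‖ := norm_pos_iff.2 hξ
  set η : ι → ℝ := ‖ξ‖⁻¹ • ξ with hη
  have hηS : η ∈ sphere (0 : ι → ℝ) 1 := by
    rw [mem_sphere_zero_iff_norm, hη, norm_smul, norm_inv, norm_norm, inv_mul_cancel₀ hnξ.ne']
  have hξη : ξ = ‖ξ‖ • η := by
    rw [hη, smul_smul, mul_inv_cancel₀ hnξ.ne', one_smul]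
  have hηn : ‖η‖ = 1 := mem_sphere_zero_iff_norm.1 hηS
  -- the form at `η`
  have h1 : lam ≤ mqf N₀ η := hmin hηS
  have h2 : |mqf N η - mqf N₀ η| ≤ c * ‖N - N₀‖ * ‖η‖ ^ 2 := abs_mqf_sub_le N N₀ η
  rw [hηn, one_pow, mul_one] at h2
  have h3 : c * ‖N - N₀‖ < lam := by
    have : c * ‖N - N₀‖ ≤ c * (lam / (c + 1)) := mul_le_mul_of_nonneg_left hN.le hc0
    have h4 : c * (lam / (c + 1)) < lam := by
      rw [mul_div_assoc']
      rw [div_lt_iff₀ (by linarith)]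
      nlinarith
    linarith
  have h5 : 0 < mqf N η := by
    have := (abs_sub_lt_iff.1 (h2.trans_lt h3)).2
    linarith
  rw [hξη, mqf_smul]
  exact mul_pos (pow_pos hnξ 2) h5

end PosDefMatrix

/-! ### Slice-hyperbolic forms -/

section SliceHyperbolic

variable {ι : Type*} [Fintype ι] (b : Module.Basis (Option ι) ℝ E)

/-- **The spatial symbol** `Q^{jk} = g^{jk} − g^{0j} g^{0k} / g⁰⁰` of a form in a basis indexed by
`Option ι` (`none` = time): the inverse of the induced metric of the slices `{t = const}`.
[cite: HawkingEllis1973CUP, §7.4] -/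
def sliceQOf (M : E →L[ℝ] E →L[ℝ] ℝ) (j k : ι) : ℝ :=
  ginvOf b M (some j) (some k) - ginvOf b M none (some j) * ginvOf b M none (some k) / ginvOf b M none none

/-- **Slice-hyperbolic forms**: invertible, `g⁰⁰ < 0`, and positive-definite spatial symbol — the
open condition under which the slices `{t = const}` are spacelike for the wave operator of `M`.
[cite: HawkingEllis1973CUP, §7.4] -/
structure IsSliceHyperbolic (M : E →L[ℝ] E →L[ℝ] ℝ) : Prop where
  isInvertible : M.IsInvertible
  g00_neg : ginvOf b M none none < 0
  posDef : MIsPosDef (sliceQOf b M)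

omit [Fintype ι] in
/-- The inverse coefficients are continuous at invertible forms. [folklore] -/
theorem continuousAt_ginvOf {M : E →L[ℝ] E →L[ℝ] ℝ} (hM : M.IsInvertible) (i j : Option ι) :
    ContinuousAt (fun M' : E →L[ℝ] E →L[ℝ] ℝ ↦ ginvOf b M' i j) M := by
  have h := contDiffAt_ginvOf b hM (0 : E →L[ℝ] E →L[ℝ] E →L[ℝ] ℝ) i j
  have hmk : ContDiffAt ℝ ∞ (fun M' : E →L[ℝ] E →L[ℝ] ℝ ↦
      ((M', (0 : E →L[ℝ] E →L[ℝ] E →L[ℝ] ℝ)) :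
        (E →L[ℝ] E →L[ℝ] ℝ) × (E →L[ℝ] E →L[ℝ] E →L[ℝ] ℝ))) M :=
    contDiffAt_id.prodMk contDiffAt_const
  exact (h.comp M hmk).continuousAt

omit [Fintype ι] in
/-- The spatial symbol is continuous at invertible forms with `g⁰⁰ ≠ 0`. [folklore] -/
theorem continuousAt_sliceQOf {M : E →L[ℝ] E →L[ℝ] ℝ} (hM : M.IsInvertible)
    (h00 : ginvOf b M none none ≠ 0) :
    ContinuousAt (fun M' : E →L[ℝ] E →L[ℝ] ℝ ↦ sliceQOf b M') M := by
  refine continuousAt_pi.2 fun j ↦ continuousAt_pi.2 fun k ↦ ?_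
  unfold sliceQOf
  exact (continuousAt_ginvOf b hM _ _).sub
    (((continuousAt_ginvOf b hM _ _).mul (continuousAt_ginvOf b hM _ _)).div
      (continuousAt_ginvOf b hM _ _) h00)

/-- **Slice-hyperbolic forms form an open set.** [cite: HawkingEllis1973CUP, §7.4] -/
theorem isOpen_setOf_isSliceHyperbolic [CompleteSpace E] :
    IsOpen {M : E →L[ℝ] E →L[ℝ] ℝ | IsSliceHyperbolic b M} := by
  refine isOpen_iff_mem_nhds.2 fun M hM ↦ ?_
  have hM' : IsSliceHyperbolic b M := hM
  -- invertibility is open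
  have h1 : ∀ᶠ M' in 𝓝 M, (M' : E →L[ℝ] E →L[ℝ] ℝ).IsInvertible := by
    have hopen := ContinuousLinearEquiv.isOpen (𝕜 := ℝ) (E := E) (F := E →L[ℝ] ℝ)
    obtain ⟨e, he⟩ := hM'.isInvertible
    have hmem : M ∈ range ((↑) : (E ≃L[ℝ] E →L[ℝ] ℝ) → E →L[ℝ] E →L[ℝ] ℝ) := ⟨e, he⟩
    filter_upwards [hopen.mem_nhds hmem] with M' hM'
    obtain ⟨e', he'⟩ := hM'
    exact ⟨e', he'⟩
  -- `g⁰⁰ < 0` is open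
  have h2 : ∀ᶠ M' in 𝓝 M, ginvOf b M' none none < 0 :=
    (continuousAt_ginvOf b hM'.isInvertible none none).eventually (Iio_mem_nhds hM'.g00_neg)
  -- positive definiteness of the spatial symbol is open
  have h3 : ∀ᶠ M' in 𝓝 M, MIsPosDef (sliceQOf b M') :=
    (continuousAt_sliceQOf b hM'.isInvertible hM'.g00_neg.ne).eventually
      (isOpen_setOf_mIsPosDef.mem_nhds hM'.posDef)
  filter_upwards [h1, h2, h3] with M' a c d
  exact ⟨a, c, d⟩

/-- **Slice-hyperbolic cut-off of a metric near a point.** If `G` is smooth, symmetric and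
nondegenerate on the open `T ∋ p₀` and `G(p₀)` is slice-hyperbolic, there is a smooth symmetric
field `Ĝ` on the whole space, slice-hyperbolic everywhere, equal to `G` on a ball around `p₀`
inside `T` and constant outside a larger ball. [cite: HawkingEllis1973CUP, §7.5] -/
theorem IsMetricOn.exists_sliceHyperbolic_cutoff [CompleteSpace E] {G : E → E →L[ℝ] E →L[ℝ] ℝ}
    {T : Set E} {p₀ : E} (hG : IsMetricOn G T) (hp₀ : p₀ ∈ T)
    (hhyp : IsSliceHyperbolic b (G p₀)) :
    ∃ Ĝ : E → E →L[ℝ] E →L[ℝ] ℝ, IsMetricOn Ĝ univ ∧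
      (∃ r, 0 < r ∧ ball p₀ r ⊆ T ∧ ∀ p ∈ ball p₀ r, Ĝ p = G p) ∧
      (∃ R, ∀ p, R ≤ dist p p₀ → Ĝ p = G p₀) ∧ ∀ p, IsSliceHyperbolic b (Ĝ p) :=
  hG.exists_cutoff hp₀ (isOpen_setOf_isSliceHyperbolic b) hhyp fun _ hM ↦ hM.isInvertible

end SliceHyperbolic

end MetricCoord

end Literature.Geometry.Lorentzian

end
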